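import Summits.Ventures.YMGap.Thresholds.OneLinkEigenCalculus
import Literature.MathematicalPhysics.QuantumFieldTheory.Balaban1983to89.StrongCouplingKernelWindow
import HarnessLib

/-!
# Venture YMGap — the one-link Kantorovich–Rubinstein modulus beyond Bakry–Émery, part 2: the modulus
# `K₁(N,R) = (N²/(N²−1)) · (1/2 + 2R)/(1/2 − R)` for every `SU(N)`, `N ≥ 2`, `R < 1/2`, hypothesis-free

HONEST FRAMING: venture file of the cell `pub-ymgap` (QuantumFields programme), strong-coupling LATTICE bookkeeping only.
The tree's hypothesis schema `OneLinkKRModulus N R K` (one-link Gibbs family `ν_B(dg) ∝ exp(N Re tr(g B)) dg` on `SU(N)`,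
`‖B‖_op ≤ R`: `|ν_B(φ) − ν_{B'}(φ)| ≤ K · Lip(φ) · ‖B − B'‖_F`) is the single constant through which every all-`N` row of
the cell passes (star door `StarMassGapSUN`, Dobrushin door `StrongCouplingDobrushinWindow`, slab/area-law door `SlabAreaLaw`).
Its hypothesis-free value in the tree is the Bakry–Émery one, `K = 1/(1/2 − R)` (`oneLinkKRModulus_SU`: the one-link Poincaré
inequality used twice).  THIS FILE proves, for every `N ≥ 2` and `R < 1/2`,

  `oneLinkKRModulus_eigen : OneLinkKRModulus N R ((N²/(N²−1)) · (1/2 + 2R)/(1/2 − R))`,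

which is smaller than `1/(1/2 − R)` exactly when `R < (N² − 2)/(4N²)` and tends to `N²/(N²−1) ∈ [1, 4/3]` instead of `2` as
`R → 0`.  METHOD (part 1, `OneLinkEigenCalculus`): the linear observable `u = Re tr(· Δ)` satisfies `Δu = −λu`,
`λ = N − 1/N`, so `u = (Γ(S,u) − L_S u)/λ`; integration by parts turns `−Cov_ν(φ, L_S u)` into `E_ν Γ(φ,u)` (`≤ Lip φ · ‖Δ‖_F`,
no curvature), and only the covariance with the explicit quadratic `Γ(S,u) = N·γ` is paid for with the one-link Poincaré
inequality (`SUNBakryEmery.haarPoincare_SU`, twice, `Lip γ ≤ 3‖B‖_op ‖Δ‖_F`).  The modulus then follows from the covariance form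
of the tilt-interpolation lemma (`abs_integral_tilted_add_sub_le_of_cov`).  What it buys and what it does not: see the cell
note `HOME/p2/ONE-LINK-MODULUS.md` (star door: beyond the sharp Bakry–Émery window `1/32` only for `N ≥ 7`, by `< 1 %`; a
base for higher orders, not a headline).  Nothing about the continuum; no mass-gap claim is made in this file.

References: H. Shen, R. Zhu, X. Zhu, CMP 400 (2023) 805–851 (arXiv:2204.12737), Lemma 4.1, Rem. 1.3 and the unnumbered remark
after it (Dobrushin route); R. L. Dobrushin, Theory Probab. Appl. 15 (1970), Thm. 4.
-/

noncomputable section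

open scoped Matrix ComplexConjugate BigOperators ContDiff Matrix.Norms.Frobenius
open Matrix Complex Finset MeasureTheory ProbabilityTheory
open Literature.MathematicalPhysics.QuantumFieldTheory
open Literature.MathematicalPhysics.QuantumFieldTheory.SUNBakryEmery
open Literature.MathematicalPhysics.QuantumFieldTheory.Balaban1983to89.StrongCouplingDobrushinWindow
open Literature.MathematicalPhysics.QuantumFieldTheory.Balaban1983to89.StrongCouplingKernelWindow

namespace Summit.Ventures.YMGap.OneLinkEigen

variable {N : ℕ}

/-! ### Small probability helpers -/

/-- **Cauchy–Schwarz for the covariance, squared form**: `cov[X, Y]² ≤ Var X · Var Y` (the discriminant of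
`t ↦ Var[X + tY] ≥ 0`). [folklore] -/
theorem cov_sq_le_var_mul_var {Ω : Type*} [MeasurableSpace Ω] {μ : Measure Ω} [IsProbabilityMeasure μ] {X Y : Ω → ℝ}
    (hX : MemLp X 2 μ) (hY : MemLp Y 2 μ) : cov[X, Y; μ] ^ 2 ≤ Var[X; μ] * Var[Y; μ] := by
  have h : ∀ t : ℝ, 0 ≤ Var[Y; μ] * (t * t) + (2 * cov[X, Y; μ]) * t + Var[X; μ] := by
    intro t
    have h1 := variance_nonneg (X + t • Y) μ
    rw [variance_add hX (hY.const_smul t), covariance_smul_right, variance_smul] at h1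
    nlinarith [h1]
  have hd := discrim_le_zero h
  rw [discrim] at hd
  nlinarith [hd]

/-- A continuous real function on `SU(N)` is bounded. [folklore] -/
theorem exists_abs_le_of_continuous {f : SUN N → ℝ} (hf : Continuous f) : ∃ C, ∀ g, |f g| ≤ C := by
  obtain ⟨C, hC⟩ := (isCompact_univ (X := SUN N)).exists_bound_of_continuousOn hf.continuousOn
  exact ⟨C, fun g => (Real.norm_eq_abs _).symm.le.trans (hC g (Set.mem_univ _))⟩

/-- A continuous real function on `SU(N)` is in `L²` of any finite measure. [folklore] -/
theorem memLp_two_of_continuous {f : SUN N → ℝ} (hf : Continuous f) (μ : Measure (SUN N)) [IsFiniteMeasure μ] :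
    MemLp f 2 μ := by
  obtain ⟨C, hC⟩ := exists_abs_le_of_continuous hf
  exact MemLp.of_bound hf.aestronglyMeasurable C (ae_of_all _ fun g => (Real.norm_eq_abs _).le.trans (hC g))

/-! ### The covariance lemma -/

/-- **Covariance of a Lipschitz observable with a linear one, first order of the eigenfunction expansion.**  For `N ≥ 2`,
`‖B‖_op < 1/2`, `φ` bounded measurable and `L`-Lipschitz (Frobenius distance) on `SU(N)`, and any `Δ`:
`|Cov_{ν_B}(φ, N Re tr(· Δ))| ≤ (N²/(N²−1)) · (1/2 + 2‖B‖_op)/(1/2 − ‖B‖_op) · L · ‖Δ‖_F`, `ν_B ∝ exp(N Re tr(g B)) dg`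
(written with the raw second moments, the shape consumed by `abs_integral_tilted_add_sub_le_of_cov`).
Proof: `u = (Γ(S,u) − L_S u)/λ` (`pot_eq_Gam_sub_genL`), `−Cov(φ, L_S u) = E Γ(F,u) + O(ε)` for smooth `ε`-approximants
`F` of `φ` with `Γ(F,F) ≤ L²` (`exists_smooth_approx`, `integral_mul_exp_mul_genL`, `Gam_pot_one_self_le`), and
`|Cov(φ, Γ(S,u))| = N |Cov(φ, γ)| ≤ N √(Var φ · Var γ)` with the one-link Poincaré inequality for both factors
(`haarPoincare_SU`, `abs_gamma_sub_le`). [cite: arXiv220412737, Lemma 4.1 and Rem. 1.3] -/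
theorem cov_linear_le (hN : 2 ≤ N) {B : Matrix (Fin N) (Fin N) ℂ} (hB : matrixOpNorm B < 1 / 2)
    (Δ : Matrix (Fin N) (Fin N) ℂ) (φ : SUN N → ℝ) {L : ℝ} (hφm : Measurable φ) (hφb : ∃ C, ∀ s, |φ s| ≤ C)
    (hL : 0 ≤ L) (hφL : ∀ a b, |φ a - φ b| ≤ L * suFrobDist a b) :
    |∫ s, φ s * ((N : ℝ) * ((s : Matrix (Fin N) (Fin N) ℂ) * Δ).trace.re)
          ∂(haarProbability (SUN N)).tilted (fun g => (N : ℝ) * ((g : Matrix (Fin N) (Fin N) ℂ) * B).trace.re) -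
        (∫ s, φ s ∂(haarProbability (SUN N)).tilted (fun g => (N : ℝ) * ((g : Matrix (Fin N) (Fin N) ℂ) * B).trace.re)) *
          ∫ s, (N : ℝ) * ((s : Matrix (Fin N) (Fin N) ℂ) * Δ).trace.re
            ∂(haarProbability (SUN N)).tilted (fun g => (N : ℝ) * ((g : Matrix (Fin N) (Fin N) ℂ) * B).trace.re)| ≤
      (N : ℝ) ^ 2 / ((N : ℝ) ^ 2 - 1) * ((1 / 2 + 2 * matrixOpNorm B) / (1 / 2 - matrixOpNorm B)) * L * frobNorm Δ := by
  have hN0 : N ≠ 0 := by omega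
  have hNpos : (0 : ℝ) < N := Nat.cast_pos.2 (Nat.pos_of_ne_zero hN0)
  have hN2 : (2 : ℝ) ≤ N := by exact_mod_cast hN
  set R : ℝ := matrixOpNorm B with hRdef
  have hR0 : 0 ≤ R := matrixOpNorm_nonneg B
  have hRpos : 0 < 1 / 2 - R := by linarith
  have hΔ0 : 0 ≤ frobNorm Δ := frobNorm_nonneg Δ
  have hden : (1 : ℝ) / 2 - R ≠ 0 := hRpos.ne'
  have hden2 : (1 : ℝ) - R * 2 ≠ 0 := by linarith
  set lam : ℝ := (N : ℝ) - 1 / N with hlam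
  have hlampos : 0 < lam := by
    have : (1 : ℝ) / N ≤ 1 / 2 := by rw [div_le_div_iff₀ hNpos (by norm_num)]; linarith
    rw [hlam]; linarith
  have hlam_eq : (N : ℝ) / lam = (N : ℝ) ^ 2 / ((N : ℝ) ^ 2 - 1) := by
    rw [hlam]; field_simp
  -- the ambient objects
  set S : Matrix (Fin N) (Fin N) ℂ → ℝ := pot (N : ℝ) B with hSdef
  set u : Matrix (Fin N) (Fin N) ℂ → ℝ := pot 1 Δ with hudef
  have hS : ContDiff ℝ ∞ S := contDiff_pot _ B
  have hu : ContDiff ℝ ∞ u := contDiff_pot _ Δ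
  set ν : Measure (SUN N) :=
    (haarProbability (SUN N)).tilted (fun g => (N : ℝ) * ((g : Matrix (Fin N) (Fin N) ℂ) * B).trace.re) with hν
  have hSg : ∀ g : SUN N, (N : ℝ) * ((g : Matrix (Fin N) (Fin N) ℂ) * B).trace.re = S g := fun g => rfl
  have hexpc : Continuous fun g : SUN N => Real.exp (S g) := Real.continuous_exp.comp (continuous_restrict hS)
  have hexpi : Integrable (fun g : SUN N => Real.exp ((N : ℝ) * ((g : Matrix (Fin N) (Fin N) ℂ) * B).trace.re))
      (haarProbability (SUN N)) := integrable_of_continuous_SUN hexpc _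
  haveI : IsProbabilityMeasure ν := isProbabilityMeasure_tilted hexpi
  set Z : ℝ := ∫ g : SUN N, Real.exp (S g) ∂(haarSU N) with hZ
  have hZpos : 0 < Z := integral_exp_pos (integrable_of_continuous_SUN hexpc _)
  have htilt : ∀ f : SUN N → ℝ, ∫ g, f g ∂ν = (∫ g : SUN N, Real.exp (S g) * f g ∂(haarSU N)) / Z := fun f => by
    rw [hν]; exact integral_tilted_eq_div _ f
  -- the observables on `SU(N)`
  set w : SUN N → ℝ := fun s => (N : ℝ) * ((s : Matrix (Fin N) (Fin N) ℂ) * Δ).trace.re with hw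
  set G : SUN N → ℝ := fun g => Gam S u g with hG
  set Lg : SUN N → ℝ := fun g => genL S u g with hLg
  set γ : SUN N → ℝ := fun g => -(1 / 2) * (B * g * Δ * g).trace.re
      - (1 / N) * (B * (g : Matrix (Fin N) (Fin N) ℂ)).trace.im * (Δ * (g : Matrix (Fin N) (Fin N) ℂ)).trace.im with hγ
  have hGc : Continuous G := continuous_restrict (contDiff_Gam hS hu)
  have hLgc : Continuous Lg := continuous_restrict (contDiff_genL hS hu)
  have hwc : Continuous w := continuous_const.mul (continuous_re_trace_su_mul Δ)
  have hφc : Continuous φ := continuous_of_lipschitz_suFrobDist hφL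
  -- pointwise identities
  have hGγ : ∀ g : SUN N, G g = (N : ℝ) * γ g + (N : ℝ) * ((1 / 2) * (B * Δᴴ).trace.re) := by
    intro g
    simp only [hG, hSdef, hudef, Gam_pot_pot_su hN0, hγ]
    ring
  have hγc : Continuous γ := by
    have : γ = fun g => (1 / (N : ℝ)) * (G g - (N : ℝ) * ((1 / 2) * (B * Δᴴ).trace.re)) := by
      funext g; rw [hGγ g]; field_simp; ring
    rw [this]
    exact continuous_const.mul (hGc.sub continuous_const)
  have hweq : w = fun g => ((N : ℝ) / lam) * (G g - Lg g) := by
    funext g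
    have h1 : w g = (N : ℝ) * pot 1 Δ g := by simp only [hw, pot, one_mul]
    rw [h1, pot_eq_Gam_sub_genL hN S 1 Δ]
    simp only [hG, hLg, hudef, hlam]
    field_simp
  -- `L²` memberships
  have mφ : MemLp φ 2 ν := by
    obtain ⟨C, hC⟩ := hφb
    exact MemLp.of_bound hφm.aestronglyMeasurable C (ae_of_all _ fun g => (Real.norm_eq_abs _).le.trans (hC g))
  have mG : MemLp G 2 ν := memLp_two_of_continuous hGc ν
  have mLg : MemLp Lg 2 ν := memLp_two_of_continuous hLgc ν
  have mγ : MemLp γ 2 ν := memLp_two_of_continuous hγc ν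
  have mw : MemLp w 2 ν := memLp_two_of_continuous hwc ν
  -- the raw covariance is `cov[φ, w; ν]`
  have hcovw : ∫ s, φ s * w s ∂ν - (∫ s, φ s ∂ν) * ∫ s, w s ∂ν = cov[φ, w; ν] := by
    rw [covariance_eq_sub mφ mw]; rfl
  -- split `w = (N/λ)(G − Lg)`
  have hsplit : cov[φ, w; ν] = ((N : ℝ) / lam) * (cov[φ, G; ν] - cov[φ, Lg; ν]) := by
    rw [hweq, show (fun g => (N : ℝ) / lam * (G g - Lg g)) = ((N : ℝ) / lam) • (G - Lg) by funext g; rfl,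
      covariance_smul_right, covariance_sub_right mφ mG mLg]
  -- (1) the integration-by-parts term: `|cov[φ, Lg]| ≤ L ‖Δ‖_F`
  have hLg0 : ∫ g, Lg g ∂ν = 0 := by
    rw [htilt, integral_exp_mul_genL_eq_zero hN0 hS hu, zero_div]
  have hcovLg : cov[φ, Lg; ν] = ∫ g, φ g * Lg g ∂ν := by
    rw [covariance_eq_sub mφ mLg, hLg0, mul_zero, sub_zero]; rfl
  obtain ⟨CL, hCL⟩ := exists_abs_le_of_continuous hLgc
  have hCL0 : 0 ≤ CL := (abs_nonneg _).trans (hCL 1)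
  have hwint : ∀ {f : SUN N → ℝ}, Continuous f → Integrable (fun g : SUN N => Real.exp (S g) * f g) (haarSU N) :=
    fun hf => integrable_of_continuous_SUN (hexpc.mul hf) _
  have hIBP : |cov[φ, Lg; ν]| ≤ L * frobNorm Δ := by
    rw [hcovLg]
    refine le_of_forall_pos_le_add fun δ hδ => ?_
    set ε : ℝ := δ / (CL + 1) with hε
    have hεpos : 0 < ε := div_pos hδ (by linarith)
    obtain ⟨F, hF, hΓF, hFφ⟩ := exists_smooth_approx hL hφL hεpos hN0
    have hFc : Continuous fun g : SUN N => F g := continuous_restrict hF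
    -- `∫ F Lg dν = -(1/Z) ∫ e^S Γ(F,u)`
    have hFLg : ∫ g, F g * Lg g ∂ν = -(∫ g : SUN N, Real.exp (S g) * Gam F u g ∂(haarSU N)) / Z := by
      rw [htilt]
      congr 1
      have : (fun g : SUN N => Real.exp (S g) * (F g * Lg g)) = fun g : SUN N => F g * (Real.exp (S g) * genL S u g) := by
        funext g; simp only [hLg]; ring
      rw [this, integral_mul_exp_mul_genL hN0 hS hF hu]
    have hΓFu : ∀ g : SUN N, |Gam F u g| ≤ L * frobNorm Δ := by
      intro g
      refine (abs_Gam_le F u g).trans ?_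
      have h1 : Real.sqrt (Gam F F g) ≤ L := by
        rw [← Real.sqrt_sq hL]; exact Real.sqrt_le_sqrt (hΓF g)
      have h2 : Real.sqrt (Gam u u g) ≤ frobNorm Δ := by
        rw [← Real.sqrt_sq (frobNorm_nonneg Δ)]
        exact Real.sqrt_le_sqrt (by rw [hudef]; exact Gam_pot_one_self_le hN0 Δ g)
      exact mul_le_mul h1 h2 (Real.sqrt_nonneg _) hL
    have hA : |∫ g, F g * Lg g ∂ν| ≤ L * frobNorm Δ := by
      rw [hFLg, abs_div, abs_neg, abs_of_pos hZpos, div_le_iff₀ hZpos]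
      calc |∫ g : SUN N, Real.exp (S g) * Gam F u g ∂(haarSU N)|
          ≤ ∫ g : SUN N, |Real.exp (S g) * Gam F u g| ∂(haarSU N) := abs_integral_le_integral_abs
        _ ≤ ∫ g : SUN N, Real.exp (S g) * (L * frobNorm Δ) ∂(haarSU N) := by
            refine integral_mono (hwint (continuous_restrict (contDiff_Gam hF hu))).abs (hwint continuous_const)
              fun g => ?_
            rw [abs_mul, abs_of_pos (Real.exp_pos _)]
            exact mul_le_mul_of_nonneg_left (hΓFu g) (Real.exp_pos _).le
        _ = L * frobNorm Δ * Z := by rw [integral_mul_const, hZ, mul_comm]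
    -- `∫ (φ - F) Lg dν` is small
    have hφi : Integrable φ ν := mφ.integrable one_le_two
    have hFi : Integrable (fun g : SUN N => F g) ν := (memLp_two_of_continuous hFc ν).integrable one_le_two
    have i1 : Integrable (fun g : SUN N => φ g * Lg g) ν := (mφ.integrable_mul mLg)
    have i2 : Integrable (fun g : SUN N => F g * Lg g) ν := ((memLp_two_of_continuous hFc ν).integrable_mul mLg)
    have hB' : |∫ g, φ g * Lg g ∂ν - ∫ g, F g * Lg g ∂ν| ≤ ε * CL := by
      rw [← integral_sub i1 i2]
      calc |∫ g, (φ g * Lg g - F g * Lg g) ∂ν| ≤ ∫ g, |φ g * Lg g - F g * Lg g| ∂ν := abs_integral_le_integral_abs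
        _ ≤ ∫ g, ε * CL ∂ν := by
            refine integral_mono (i1.sub i2).abs (integrable_const _) fun g => ?_
            rw [← sub_mul, abs_mul]
            refine mul_le_mul ?_ (hCL g) (abs_nonneg _) hεpos.le
            rw [abs_sub_comm]; exact hFφ g
        _ = ε * CL := by simp
    have hεCL : ε * CL ≤ δ := by
      rw [hε, div_mul_eq_mul_div, div_le_iff₀ (by linarith)]
      nlinarith
    calc |∫ g, φ g * Lg g ∂ν| = |(∫ g, φ g * Lg g ∂ν - ∫ g, F g * Lg g ∂ν) + ∫ g, F g * Lg g ∂ν| := by ring_nf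
      _ ≤ |∫ g, φ g * Lg g ∂ν - ∫ g, F g * Lg g ∂ν| + |∫ g, F g * Lg g ∂ν| := abs_add_le _ _
      _ ≤ δ + L * frobNorm Δ := add_le_add (hB'.trans hεCL) hA
      _ = L * frobNorm Δ + δ := add_comm _ _
  -- (2) the Poincaré term: `|cov[φ, G]| = N |cov[φ, γ]| ≤ 3 R L ‖Δ‖_F / (1/2 − R)`
  have hcovG : cov[φ, G; ν] = (N : ℝ) * cov[φ, γ; ν] := by
    have : G = fun g => (N : ℝ) * γ g + (N : ℝ) * ((1 / 2) * (B * Δᴴ).trace.re) := funext hGγ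
    rw [this, covariance_add_const_right ((mγ.const_mul _).integrable one_le_two), covariance_const_mul_right]
  have hvarφ : Var[φ; ν] ≤ L ^ 2 / ((N : ℝ) * (1 / 2 - R)) := haarPoincare_SU hN B hB φ L hL hφL
  have hγL : ∀ a b : SUN N, |γ a - γ b| ≤ 3 * R * frobNorm Δ * suFrobDist a b := fun a b => by
    simp only [hγ]; exact abs_gamma_sub_le hN0 B Δ a b
  have hvarγ : Var[γ; ν] ≤ (3 * R * frobNorm Δ) ^ 2 / ((N : ℝ) * (1 / 2 - R)) :=
    haarPoincare_SU hN B hB γ (3 * R * frobNorm Δ) (by positivity) hγL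
  have hK : 0 < (N : ℝ) * (1 / 2 - R) := mul_pos hNpos hRpos
  have hPoinc : |cov[φ, G; ν]| ≤ 3 * R * L * frobNorm Δ / (1 / 2 - R) := by
    rw [hcovG, abs_mul, abs_of_pos hNpos]
    have h1 : |cov[φ, γ; ν]| ≤ L * (3 * R * frobNorm Δ) / ((N : ℝ) * (1 / 2 - R)) := by
      have hcs : |cov[φ, γ; ν]| ≤ Real.sqrt (Var[φ; ν] * Var[γ; ν]) := by
        rw [← Real.sqrt_sq_eq_abs]; exact Real.sqrt_le_sqrt (cov_sq_le_var_mul_var mφ mγ)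
      refine hcs.trans ?_
      have hprod : Var[φ; ν] * Var[γ; ν] ≤ (L * (3 * R * frobNorm Δ) / ((N : ℝ) * (1 / 2 - R))) ^ 2 := by
        calc Var[φ; ν] * Var[γ; ν] ≤ (L ^ 2 / ((N : ℝ) * (1 / 2 - R))) * ((3 * R * frobNorm Δ) ^ 2 / ((N : ℝ) * (1 / 2 - R))) :=
              mul_le_mul hvarφ hvarγ (variance_nonneg _ _) (by positivity)
          _ = (L * (3 * R * frobNorm Δ) / ((N : ℝ) * (1 / 2 - R))) ^ 2 := by field_simp
      calc Real.sqrt (Var[φ; ν] * Var[γ; ν]) ≤ Real.sqrt ((L * (3 * R * frobNorm Δ) / ((N : ℝ) * (1 / 2 - R))) ^ 2) :=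
            Real.sqrt_le_sqrt hprod
        _ = L * (3 * R * frobNorm Δ) / ((N : ℝ) * (1 / 2 - R)) := Real.sqrt_sq (by positivity)
    calc (N : ℝ) * |cov[φ, γ; ν]| ≤ (N : ℝ) * (L * (3 * R * frobNorm Δ) / ((N : ℝ) * (1 / 2 - R))) :=
          mul_le_mul_of_nonneg_left h1 hNpos.le
      _ = 3 * R * L * frobNorm Δ / (1 / 2 - R) := by field_simp
  -- (3) assemble
  rw [hcovw, hsplit, abs_mul, abs_of_pos (div_pos hNpos hlampos), hlam_eq]
  have hfin : |cov[φ, G; ν] - cov[φ, Lg; ν]| ≤ 3 * R * L * frobNorm Δ / (1 / 2 - R) + L * frobNorm Δ :=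
    (abs_sub _ _).trans (add_le_add hPoinc hIBP)
  have hN21 : (0 : ℝ) < (N : ℝ) ^ 2 - 1 := by nlinarith
  calc (N : ℝ) ^ 2 / ((N : ℝ) ^ 2 - 1) * |cov[φ, G; ν] - cov[φ, Lg; ν]|
      ≤ (N : ℝ) ^ 2 / ((N : ℝ) ^ 2 - 1) * (3 * R * L * frobNorm Δ / (1 / 2 - R) + L * frobNorm Δ) :=
        mul_le_mul_of_nonneg_left hfin (by positivity)
    _ = (N : ℝ) ^ 2 / ((N : ℝ) ^ 2 - 1) * ((1 / 2 + 2 * R) / (1 / 2 - R)) * L * frobNorm Δ := by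
        have e : 3 * R * L * frobNorm Δ / (1 / 2 - R) + L * frobNorm Δ = (1 / 2 + 2 * R) / (1 / 2 - R) * L * frobNorm Δ := by
          rw [div_add' _ _ _ hden, div_mul_eq_mul_div, div_mul_eq_mul_div, div_eq_div_iff hden hden]
          ring
        rw [e]; ring

/-! ### The modulus -/

/-- The first-order constant is monotone in the radius on `[0, 1/2)`. [folklore] -/
theorem eigenConst_mono {r R : ℝ} (hrR : r ≤ R) (hR : R < 1 / 2) :
    (1 / 2 + 2 * r) / (1 / 2 - r) ≤ (1 / 2 + 2 * R) / (1 / 2 - R) := by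
  rw [div_le_div_iff₀ (by linarith) (by linarith)]
  nlinarith

/-- **THE ONE-LINK KANTOROVICH–RUBINSTEIN MODULUS BEYOND BAKRY–ÉMERY, EVERY `SU(N)`, `N ≥ 2`, HYPOTHESIS-FREE**:
for `R < 1/2`, `OneLinkKRModulus N R ((N²/(N²−1)) · (1/2 + 2R)/(1/2 − R))` — on the operator-norm ball `‖B‖_op ≤ R`,
`|ν_B(φ) − ν_{B'}(φ)| ≤ K₁ · L · ‖B − B'‖_F` for every bounded measurable `L`-Lipschitz `φ`.  Compare the tree's Bakry–Émery
value `1/(1/2 − R)` (`oneLinkKRModulus_SU`): `K₁` is smaller iff `R < (N² − 2)/(4N²)`, and `K₁ → N²/(N²−1)` vs `2` as `R → 0`.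
Proof: `cov_linear_le` along the segment `B_t = B + t(B' − B)` (convexity of the ball) and the covariance form of the
tilt-interpolation lemma `abs_integral_tilted_add_sub_le_of_cov`. [cite: arXiv220412737, Lemma 4.1 and Rem. 1.3] -/
theorem oneLinkKRModulus_eigen (hN : 2 ≤ N) {R : ℝ} (hR : R < 1 / 2) :
    OneLinkKRModulus N R ((N : ℝ) ^ 2 / ((N : ℝ) ^ 2 - 1) * ((1 / 2 + 2 * R) / (1 / 2 - R))) := by
  classical
  intro B B' hB hB' φ L hφm hφb hL hφL
  have hN0 : N ≠ 0 := by omega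
  have hNpos : (0 : ℝ) < N := Nat.cast_pos.2 (Nat.pos_of_ne_zero hN0)
  have hN2 : (2 : ℝ) ≤ N := by exact_mod_cast hN
  have hR0 : 0 ≤ R := (matrixOpNorm_nonneg B).trans hB
  set f : SUN N → ℝ := fun g => (N : ℝ) * ((g : Matrix (Fin N) (Fin N) ℂ) * B).trace.re with hf
  set w : SUN N → ℝ := fun g => (N : ℝ) * ((g : Matrix (Fin N) (Fin N) ℂ) * (B' - B)).trace.re with hw
  have hfw : (fun g : SUN N => (N : ℝ) * ((g : Matrix (Fin N) (Fin N) ℂ) * B').trace.re) = fun g => f g + w g := by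
    funext g
    simp only [hf, hw, Matrix.mul_sub, trace_sub, Complex.sub_re]
    ring
  rw [hfw, abs_sub_comm]
  -- measurability and bounds
  have hfm : Measurable f := (continuous_const.mul (continuous_re_trace_su_mul B)).measurable
  have hwm : Measurable w := (continuous_const.mul (continuous_re_trace_su_mul (B' - B))).measurable
  have hfb : ∃ C, ∀ s, |f s| ≤ C := ⟨(N : ℝ) * (Real.sqrt N * frobNorm B), fun s => by
    simp only [hf]
    rw [abs_mul, abs_of_nonneg hNpos.le]
    exact mul_le_mul_of_nonneg_left (abs_re_trace_su_mul_le s B) hNpos.le⟩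
  have hwb : ∀ s, |w s| ≤ (N : ℝ) * (Real.sqrt N * frobNorm (B' - B)) := fun s => by
    simp only [hw]
    rw [abs_mul, abs_of_nonneg hNpos.le]
    exact mul_le_mul_of_nonneg_left (abs_re_trace_su_mul_le s _) hNpos.le
  have key := abs_integral_tilted_add_sub_le_of_cov (μ := haarProbability (SUN N))
    (A := (N : ℝ) ^ 2 / ((N : ℝ) ^ 2 - 1) * ((1 / 2 + 2 * R) / (1 / 2 - R)) * L * frobNorm (B' - B))
    hfm hfb hwm hwb hφm hφb ?_
  · rw [frobNorm_sub_comm] at key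
    exact key
  · -- the covariance bound along the interpolation, supplied by `cov_linear_le`
    intro t ht
    set Bt : Matrix (Fin N) (Fin N) ℂ := B + (t : ℂ) • (B' - B) with hBt
    have hft : (fun u : SUN N => f u + t * w u) =
        fun g : SUN N => (N : ℝ) * ((g : Matrix (Fin N) (Fin N) ℂ) * Bt).trace.re := by
      funext g
      simp only [hf, hw, hBt, Matrix.mul_add, Matrix.mul_smul, trace_add, trace_smul, Complex.add_re, smul_eq_mul,
        Complex.re_ofReal_mul]
      ring
    have hBt_le : matrixOpNorm Bt ≤ R := by
      have h1 : Bt = ((1 - t : ℝ) : ℂ) • B + ((t : ℝ) : ℂ) • B' := by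
        rw [hBt]; push_cast; simp only [smul_sub, sub_smul, one_smul]; abel
      rw [h1]
      calc matrixOpNorm (((1 - t : ℝ) : ℂ) • B + ((t : ℝ) : ℂ) • B')
          ≤ matrixOpNorm (((1 - t : ℝ) : ℂ) • B) + matrixOpNorm (((t : ℝ) : ℂ) • B') := matrixOpNorm_add_le _ _
        _ = (1 - t) * matrixOpNorm B + t * matrixOpNorm B' := by
            rw [matrixOpNorm_smul, matrixOpNorm_smul, Complex.norm_real, Complex.norm_real, Real.norm_eq_abs,
              Real.norm_eq_abs, abs_of_nonneg (by linarith [ht.2]), abs_of_nonneg ht.1]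
        _ ≤ (1 - t) * R + t * R :=
            add_le_add (mul_le_mul_of_nonneg_left hB (by linarith [ht.2])) (mul_le_mul_of_nonneg_left hB' ht.1)
        _ = R := by ring
    have hBt_lt : matrixOpNorm Bt < 1 / 2 := lt_of_le_of_lt hBt_le hR
    have hcov := cov_linear_le hN hBt_lt (B' - B) φ hφm hφb hL hφL
    rw [← hft] at hcov
    refine hcov.trans ?_
    have hmono := eigenConst_mono hBt_le hR
    have hN21 : (0 : ℝ) < (N : ℝ) ^ 2 - 1 := by nlinarith
    have hc0 : 0 ≤ (N : ℝ) ^ 2 / ((N : ℝ) ^ 2 - 1) := by positivity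
    have := mul_le_mul_of_nonneg_left hmono hc0
    exact mul_le_mul_of_nonneg_right (mul_le_mul_of_nonneg_right this hL) (frobNorm_nonneg _)

/-- **The first-order modulus beats the Bakry–Émery modulus exactly for `R < (N² − 2)/(4N²)`**
(`N = 2`: `R < 1/8`; `N = 3`: `R < 7/36`; `N → ∞`: `R < 1/4`); at `R = 0` it equals `N²/(N² − 1) ≤ 4/3` against `2`.
[folklore] -/
theorem eigenModulus_lt_bakryEmery (hN : 2 ≤ N) {R : ℝ} (hR0 : 0 ≤ R)
    (h : R < ((N : ℝ) ^ 2 - 2) / (4 * (N : ℝ) ^ 2)) :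
    (N : ℝ) ^ 2 / ((N : ℝ) ^ 2 - 1) * ((1 / 2 + 2 * R) / (1 / 2 - R)) < 1 / (1 / 2 - R) := by
  have hN2 : (2 : ℝ) ≤ N := by exact_mod_cast hN
  have hN21 : (0 : ℝ) < (N : ℝ) ^ 2 - 1 := by nlinarith
  have hNsq : (0 : ℝ) < 4 * (N : ℝ) ^ 2 := by positivity
  have h' : R * (4 * (N : ℝ) ^ 2) < (N : ℝ) ^ 2 - 2 := (lt_div_iff₀ hNsq).1 h
  have hR : R < 1 / 2 := by nlinarith
  have hRpos : 0 < 1 / 2 - R := by linarith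
  have key : (N : ℝ) ^ 2 / ((N : ℝ) ^ 2 - 1) * (1 / 2 + 2 * R) < 1 := by
    rw [div_mul_eq_mul_div, div_lt_one hN21]; nlinarith
  calc (N : ℝ) ^ 2 / ((N : ℝ) ^ 2 - 1) * ((1 / 2 + 2 * R) / (1 / 2 - R))
      = ((N : ℝ) ^ 2 / ((N : ℝ) ^ 2 - 1) * (1 / 2 + 2 * R)) / (1 / 2 - R) := by ring
    _ < 1 / (1 / 2 - R) := (div_lt_div_iff_of_pos_right hRpos).2 key

/-- **Both moduli at once**: the minimum of the Bakry–Émery and the first-order constants is again a modulus. [folklore] -/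
theorem oneLinkKRModulus_min (hN : 2 ≤ N) {R : ℝ} (hR : R < 1 / 2) :
    OneLinkKRModulus N R (min (1 / (1 / 2 - R)) ((N : ℝ) ^ 2 / ((N : ℝ) ^ 2 - 1) * ((1 / 2 + 2 * R) / (1 / 2 - R)))) := by
  intro B B' hB hB' φ L hφm hφb hL hφL
  rcases min_cases (1 / (1 / 2 - R)) ((N : ℝ) ^ 2 / ((N : ℝ) ^ 2 - 1) * ((1 / 2 + 2 * R) / (1 / 2 - R))) with ⟨h, _⟩ | ⟨h, _⟩
  · rw [h]; exact oneLinkKRModulus_SU hN hR B B' hB hB' φ L hφm hφb hL hφL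
  · rw [h]; exact oneLinkKRModulus_eigen hN hR B B' hB hB' φ L hφm hφb hL hφL

end Summit.Ventures.YMGap.OneLinkEigen
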